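import Summits.QuantumFields.BalabanUV.Beta.ValueHessianBlind
import Summits.QuantumFields.BalabanUV.Beta.KernelWardRelative

/-!
# `BalabanUV.Beta.ValueHessianGauge` — binder row D1, hW skeleton sub-leaf (W-LH-E2): THE TYPED VALUE HESSIAN KILLS PURE GAUGES —
# `Σ'_y Σ_l E2 d Lc j (x, y)_{κ l} · (φ(y + e_l) − φ(y)) = 0` for every finitely supported potential `φ`, every step `j`, every dimension;
# in particular against the block pure gauge `gaugeWt Lc y` of `KernelWardRelative`, and for the field block `wVH • E2` of the step
# candidate `bhKStepAt d ρ Lc (j+1)` — the `j ≥ 1` replacement for `curv_dz` in the (W-LH) derivation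

HONEST FRAMING (cell contract, verbatim): «discharging `BetaPertH` makes Bałaban's UV stability UNCONDITIONAL — a real constructive-QFT
result; it is NOT the continuum limit and NOT the Clay problem.»  HONEST DEPENDENCY (verbatim): «continuum YM on T⁴ ⇐ BetaPertH ∧ nine
spine estimates (0/9 proved); BetaPertH ⇐ (D1) ∧ (D4) ∧ CAP+tail; G-an2-4 gates asym, D1 and NE2/3/4.»  THIS MODULE DISCHARGES NOTHING of
the wall: it is [folklore] summation by parts on `ℤ^{d+1}` against a finitely supported potential, fed by an2's co-closedness of the
multiplier response (`BorderedHessian.codiff₁_wΦ_right` / `codiff₁_wΦ_shift`, `ValueHessianBlind` p206523, themselves from an5's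
`ResolventComposition.wH_EL'`) and the entry dictionary `E2_inl_inl_eq_wΦ`.  No `Prop` is minted, no `def`, nothing printed is asserted,
0 sorry.  «not in print; our proof».  NOT summit progress; NOT BetaPertH, NOT continuum, NOT Clay.

ABSOLUTE RULE (cell, verbatim): «No internally-minted statement may enter as a cited fact. Every hypothesis is either kernel-proved in this
package or a verbatim quotation of a PUBLISHED theorem with page reference. The manuscript(s) under audit are NOT citable for their own
disputed steps — they are the thing under adjudication; programme-internal (2001/route/tribunal) claims are never citable.»

WHY (an1-g25's `HOME/b2b-balaban-beta-an1-g25/SKELETON-D1-hW.v1.md` §2 (W-LH)).  The ℋ-column Ward law (W-LH)_j is derived by contracting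
rule AME of the relative inverse (`(G_j ∘ 𝕄_j) ∘ E = E`, an2's (L1)) with the test vector `w := (d 1_{B(y)} ; 0)`; step (ii) needs
`𝕄_j w`'s FIELD entry to vanish.  At `j = 0` (`𝕄_0 = bhKAt`, field block = windowed `curvAdj ∘ curv`) this is `AffineAveraging.curv_dz`;
at `j ≥ 1` the field block of `𝕄_j = bhKStepAt d ρ Lc j` is `wVH d Lc j • E2 d Lc j` (`bhKStepAt_succ_inl_inl`), the value-function Hessian,
and the skeleton records the needed fact as the SUB-LEAF «(W-LH-E2)_j: `E2` kills pure gauges — gauge invariance of the typed value Hessian,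
statement-level, NOT in the tree as such».  THIS FILE PROVES IT, for every `j` and every finitely supported potential (not only block
indicators): the field–field entry of `E2 d Lc j` is `wΦ^{(Lc^j)} κ l (x − y)` and `wΦ` is co-closed in its second slot, so
`Σ_y Σ_l wΦ κ l (x − y)·(φ(y + e_l) − φ(y)) = −Σ_y (codiff₁ wΦ_{κ,x})(y)·φ(y) = 0` after shifting the first series by `e_l`.

CONTENT (all [folklore]).
* §1 finiteness/summability bookkeeping (`finite_support_mul_right`, `finite_support_comp_add`, `summable_of_finSupp_*`), the shift
  `tsum_mul_comp_add_shift`, and the two `unitVec`s of the tree agree (`bUnitVec_eq`).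
* §2 **`tsum_wΦ_mul_grad_eq_zero`**: `∑' y, ∑ l, wΦ κ l (x − y) * (φ (y + e_l) − φ y) = 0` (column form, `codiff₁_wΦ_right`) and the row twin
  **`tsum_grad_mul_wΦ_eq_zero`**: `∑' x, ∑ κ, (φ (x + e_κ) − φ x) * wΦ κ l (x − y) = 0` (`codiff₁_wΦ_shift`).
* §3 **`tsum_E2_mul_grad_eq_zero`** / `tsum_grad_mul_E2_eq_zero` (the value Hessian `E2 d Lc j`, any `j`), the block instance
  **`tsum_E2_mul_gaugeWt_eq_zero`** (`gaugeWt Lc y` of `KernelWardRelative`; the block `B(y)` is finite: `blk_add_off`/`off_mem_box`), and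
  **`tsum_bhKStepAt_succ_ff_mul_gaugeWt_eq_zero`** (the step candidate's field block at `j + 1`).
-/

noncomputable section

namespace Summit.QuantumFields.BalabanUV.Beta.ValueHessianGauge

open Finset
open scoped BigOperators
open Literature.MathematicalPhysics.QuantumFieldTheory
open Literature.MathematicalPhysics.QuantumFieldTheory.Balaban1983to89
open Literature.MathematicalPhysics.QuantumFieldTheory.Balaban1983to89.Beta
open ExpKernelCalculus (Site MKer)
open AffineAveraging (unitVec codiff₁ box toSite)
open AveragingContours (blk off off_mem_box blk_add_off)
open KernelSpecInstance (wΦ)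
open OneStepResolventKernel (Fib)
open BalabanStepJetsSucc (E2)
open Summit.QuantumFields.BalabanUV.Beta.BorderedHessian (E2_inl_inl_eq_wΦ codiff₁_wΦ_right codiff₁_wΦ_shift bhKStepAt
  bhKStepAt_succ_inl_inl)
open Summit.QuantumFields.BalabanUV.Beta.KernelWardRelative (gaugeWt)

variable {d : ℕ}

/-! ## §1 Bookkeeping: finitely supported products are summable; shifting a series; the two `unitVec`s -/

/-- [folklore] `support (w · φ) ⊆ support φ`, so it is finite when `φ` is finitely supported. -/
theorem finite_support_mul_right {D : ℕ} (w φ : Site D → ℝ) (hφ : (Function.support φ).Finite) :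
    (Function.support fun y => w y * φ y).Finite :=
  hφ.subset (Function.support_mul_subset_right w φ)

/-- [folklore] `y ↦ φ (y + v)` is finitely supported when `φ` is (translation is injective). -/
theorem finite_support_comp_add {D : ℕ} (φ : Site D → ℝ) (hφ : (Function.support φ).Finite) (v : Site D) :
    (Function.support fun y => φ (y + v)).Finite := by
  have h : (Function.support fun y => φ (y + v)) = (fun y => y + v) ⁻¹' Function.support φ := by
    ext y; simp [Function.mem_support]
  rw [h]
  exact hφ.preimage fun a _ b _ hab => add_right_cancel hab

/-- [folklore] `y ↦ w y · φ y` is summable for finitely supported `φ`. -/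
theorem summable_mul_of_finSupp {D : ℕ} (w φ : Site D → ℝ) (hφ : (Function.support φ).Finite) :
    Summable fun y => w y * φ y :=
  summable_of_hasFiniteSupport (finite_support_mul_right w φ hφ)

/-- [folklore] `y ↦ w y · φ (y + v)` is summable for finitely supported `φ`. -/
theorem summable_mul_comp_add_of_finSupp {D : ℕ} (w φ : Site D → ℝ) (hφ : (Function.support φ).Finite) (v : Site D) :
    Summable fun y => w y * φ (y + v) :=
  summable_of_hasFiniteSupport (finite_support_mul_right w _ (finite_support_comp_add φ hφ v))

/-- [folklore] SHIFT: `Σ'_y w (x − y) · φ (y + v) = Σ'_y w (x − y + v) · φ y` (re-index `y ↦ y − v`; no summability needed). -/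
theorem tsum_mul_comp_add_shift {D : ℕ} (w φ : Site D → ℝ) (x v : Site D) :
    ∑' y, w (x - y) * φ (y + v) = ∑' y, w (x - y + v) * φ y := by
  rw [← (Equiv.subRight v).tsum_eq (fun y => w (x - y) * φ (y + v))]
  refine tsum_congr fun y => ?_
  simp only [Equiv.subRight_apply, sub_add_cancel]
  congr 1
  congr 1
  abel

/-- [folklore] The two unit vectors of the tree agree: `B6BondElimination.unitVec l = AffineAveraging.unitVec l` (`Pi.single l 1`). -/
theorem bUnitVec_eq {D : ℕ} (l : Fin D) : B6BondElimination.unitVec l = AffineAveraging.unitVec l := by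
  funext i
  simp only [B6BondElimination.unitVec, AffineAveraging.unitVec, Pi.single_apply]

/-! ## §2 The multiplier response `wΦ` kills pure gauges (column and row forms) -/

section WΦ

variable {N : ℕ} [NeZero N]

/-- [folklore] **`wΦ` KILLS PURE GAUGES (column form)**: for every finitely supported potential `φ` on `ℤ^{d+1}`,
`Σ'_y Σ_l wΦ κ l (x − y) · (φ (y + e_l) − φ y) = 0` — summation by parts + `codiff₁_wΦ_right` (co-closedness in the second slot). -/
theorem tsum_wΦ_mul_grad_eq_zero (κ : Fin (d + 1)) (x : Site (d + 1)) {φ : Site (d + 1) → ℝ} (hφ : (Function.support φ).Finite) :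
    ∑' y, ∑ l, wΦ (N := N) κ l (x - y) * (φ (y + unitVec l) - φ y) = 0 := by
  -- per-direction pieces
  have hf : ∀ l : Fin (d + 1), Summable fun y => wΦ (N := N) κ l (x - y) * φ (y + unitVec l) := fun l =>
    summable_mul_comp_add_of_finSupp (fun y => wΦ (N := N) κ l (x - y)) φ hφ (unitVec l)
  have hg : ∀ l : Fin (d + 1), Summable fun y => wΦ (N := N) κ l (x - y) * φ y := fun l =>
    summable_mul_of_finSupp (fun y => wΦ (N := N) κ l (x - y)) φ hφ
  have hfg : ∀ l : Fin (d + 1), Summable fun y => wΦ (N := N) κ l (x - y) * (φ (y + unitVec l) - φ y) := fun l =>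
    ((hf l).sub (hg l)).congr fun y => by ring
  -- the shifted kernel times `φ` is summable too
  have hs : ∀ l : Fin (d + 1), Summable fun y => wΦ (N := N) κ l (x - y + unitVec l) * φ y := fun l =>
    summable_mul_of_finSupp (fun y => wΦ (N := N) κ l (x - y + unitVec l)) φ hφ
  calc ∑' y, ∑ l, wΦ (N := N) κ l (x - y) * (φ (y + unitVec l) - φ y)
      = ∑ l, ∑' y, wΦ (N := N) κ l (x - y) * (φ (y + unitVec l) - φ y) :=
        Summable.tsum_finsetSum fun l _ => hfg l
    _ = ∑ l, ((∑' y, wΦ (N := N) κ l (x - y + unitVec l) * φ y) - ∑' y, wΦ (N := N) κ l (x - y) * φ y) := by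
        refine Finset.sum_congr rfl fun l _ => ?_
        rw [← tsum_mul_comp_add_shift (fun z => wΦ (N := N) κ l z) φ x (unitVec l), ← (hf l).tsum_sub (hg l)]
        exact tsum_congr fun y => by ring
    _ = ∑ l, ∑' y, (wΦ (N := N) κ l (x - y + unitVec l) - wΦ (N := N) κ l (x - y)) * φ y := by
        refine Finset.sum_congr rfl fun l _ => ?_
        rw [← (hs l).tsum_sub (hg l)]
        exact tsum_congr fun y => by ring
    _ = ∑' y, ∑ l, (wΦ (N := N) κ l (x - y + unitVec l) - wΦ (N := N) κ l (x - y)) * φ y :=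
        (Summable.tsum_finsetSum fun l _ => ((hs l).sub (hg l)).congr fun y => by ring).symm
    _ = ∑' y, codiff₁ (fun l z => wΦ (N := N) κ l (x - z)) y * φ y := by
        refine tsum_congr fun y => ?_
        rw [← Finset.sum_mul]
        congr 1
        simp only [codiff₁]
        refine Finset.sum_congr rfl fun l _ => ?_
        have e : x - (y - unitVec l) = x - y + unitVec l := by abel
        rw [e]
    _ = 0 := by
        simp [codiff₁_wΦ_right (N := N) κ x]

/-- [folklore] **`wΦ` KILLS PURE GAUGES (row form)**: `Σ'_x Σ_κ (φ (x + e_κ) − φ x) · wΦ κ l (x − y) = 0` (`codiff₁_wΦ_shift`,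
co-closedness in the first slot). -/
theorem tsum_grad_mul_wΦ_eq_zero (l : Fin (d + 1)) (y : Site (d + 1)) {φ : Site (d + 1) → ℝ} (hφ : (Function.support φ).Finite) :
    ∑' x, ∑ κ, (φ (x + unitVec κ) - φ x) * wΦ (N := N) κ l (x - y) = 0 := by
  have hf : ∀ κ : Fin (d + 1), Summable fun x => wΦ (N := N) κ l (x - y) * φ (x + unitVec κ) := fun κ =>
    summable_mul_comp_add_of_finSupp (fun x => wΦ (N := N) κ l (x - y)) φ hφ (unitVec κ)
  have hg : ∀ κ : Fin (d + 1), Summable fun x => wΦ (N := N) κ l (x - y) * φ x := fun κ =>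
    summable_mul_of_finSupp (fun x => wΦ (N := N) κ l (x - y)) φ hφ
  have hfg : ∀ κ : Fin (d + 1), Summable fun x => (φ (x + unitVec κ) - φ x) * wΦ (N := N) κ l (x - y) := fun κ =>
    ((hf κ).sub (hg κ)).congr fun x => by ring
  have hs : ∀ κ : Fin (d + 1), Summable fun x => wΦ (N := N) κ l (x - unitVec κ - y) * φ x := fun κ =>
    summable_mul_of_finSupp (fun x => wΦ (N := N) κ l (x - unitVec κ - y)) φ hφ
  -- shift `x ↦ x − e_κ` in the first series: `Σ'_x wΦ κ l (x − y) φ(x + e_κ) = Σ'_x wΦ κ l (x − e_κ − y) φ x`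
  have hshift : ∀ κ : Fin (d + 1), ∑' x, wΦ (N := N) κ l (x - y) * φ (x + unitVec κ)
      = ∑' x, wΦ (N := N) κ l (x - unitVec κ - y) * φ x := by
    intro κ
    rw [← (Equiv.subRight (unitVec κ)).tsum_eq (fun x => wΦ (N := N) κ l (x - y) * φ (x + unitVec κ))]
    refine tsum_congr fun x => ?_
    simp only [Equiv.subRight_apply, sub_add_cancel]
  calc ∑' x, ∑ κ, (φ (x + unitVec κ) - φ x) * wΦ (N := N) κ l (x - y)
      = ∑ κ, ∑' x, (φ (x + unitVec κ) - φ x) * wΦ (N := N) κ l (x - y) :=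
        Summable.tsum_finsetSum fun κ _ => hfg κ
    _ = ∑ κ, ((∑' x, wΦ (N := N) κ l (x - unitVec κ - y) * φ x) - ∑' x, wΦ (N := N) κ l (x - y) * φ x) := by
        refine Finset.sum_congr rfl fun κ _ => ?_
        rw [← hshift κ, ← (hf κ).tsum_sub (hg κ)]
        exact tsum_congr fun x => by ring
    _ = ∑ κ, ∑' x, (wΦ (N := N) κ l (x - unitVec κ - y) - wΦ (N := N) κ l (x - y)) * φ x := by
        refine Finset.sum_congr rfl fun κ _ => ?_
        rw [← (hs κ).tsum_sub (hg κ)]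
        exact tsum_congr fun x => by ring
    _ = ∑' x, ∑ κ, (wΦ (N := N) κ l (x - unitVec κ - y) - wΦ (N := N) κ l (x - y)) * φ x :=
        (Summable.tsum_finsetSum fun κ _ => ((hs κ).sub (hg κ)).congr fun x => by ring).symm
    _ = ∑' x, codiff₁ (fun κ z => wΦ (N := N) κ l (z - y)) x * φ x := by
        refine tsum_congr fun x => ?_
        rw [← Finset.sum_mul]
        rfl
    _ = 0 := by
        simp [codiff₁_wΦ_shift (N := N) l y]

end WΦ

/-! ## §3 The value Hessian `E2 d Lc j`, the block pure gauge `gaugeWt`, and the step candidate's field block -/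

section ValueHessian

variable {Lc : ℕ} [NeZero Lc]

/-- [folklore] **THE TYPED VALUE HESSIAN KILLS PURE GAUGES** (every step `j`, every finitely supported potential; column form):
`Σ'_y Σ_l E2 d Lc j (x, y)_{inl κ, inl l} · (φ (y + e_l) − φ y) = 0`. -/
theorem tsum_E2_mul_grad_eq_zero (j : ℕ) (κ : Fin (d + 1)) (x : Site (d + 1)) {φ : Site (d + 1) → ℝ}
    (hφ : (Function.support φ).Finite) :
    ∑' y, ∑ l, E2 d Lc j x y (Sum.inl κ) (Sum.inl l) * (φ (y + unitVec l) - φ y) = 0 := by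
  simp only [E2_inl_inl_eq_wΦ]
  exact tsum_wΦ_mul_grad_eq_zero (N := Lc ^ j) κ x hφ

/-- [folklore] The row form: `Σ'_x Σ_κ (φ (x + e_κ) − φ x) · E2 d Lc j (x, y)_{inl κ, inl l} = 0`. -/
theorem tsum_grad_mul_E2_eq_zero (j : ℕ) (l : Fin (d + 1)) (y : Site (d + 1)) {φ : Site (d + 1) → ℝ}
    (hφ : (Function.support φ).Finite) :
    ∑' x, ∑ κ, (φ (x + unitVec κ) - φ x) * E2 d Lc j x y (Sum.inl κ) (Sum.inl l) = 0 := by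
  simp only [E2_inl_inl_eq_wΦ]
  exact tsum_grad_mul_wΦ_eq_zero (N := Lc ^ j) l y hφ

/-- [folklore] The block indicator `1_{B(y)}` (blocking `L ≥ 1`) is finitely supported: `B(y) = L•y + box`. -/
theorem finite_support_blockInd {L : ℕ} (hL : 1 ≤ L) (y : Site (d + 1)) :
    (Function.support fun u : Site (d + 1) => if blk L u = y then (1 : ℝ) else 0).Finite := by
  refine (Set.Finite.image (fun b : Fin (d + 1) → ℕ => (L : ℤ) • y + toSite b) (box (d + 1) L).finite_toSet).subset ?_
  intro u hu
  have hb : blk L u = y := by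
    by_contra h
    simp only [Function.mem_support, if_neg h, ne_eq, not_true_eq_false] at hu
  refine ⟨off L u, Finset.mem_coe.mpr (off_mem_box hL u), ?_⟩
  have := blk_add_off hL u
  rw [hb] at this
  exact this

/-- [folklore] `gaugeWt L y l u` IS the gradient of the block indicator `1_{B(y)}` read on the bond `(u, l)` (with `AffineAveraging.unitVec`). -/
theorem gaugeWt_eq_grad (L : ℕ) (y : Site (d + 1)) (l : Fin (d + 1)) (u : Site (d + 1)) :
    gaugeWt L y l u = (if blk L (u + unitVec l) = y then (1 : ℝ) else 0) - (if blk L u = y then (1 : ℝ) else 0) := by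
  simp only [gaugeWt, bUnitVec_eq]

/-- [folklore] **(W-LH-E2)_j, BLOCK FORM**: the value Hessian contracted with the block pure gauge vanishes,
`Σ'_u Σ_l E2 d Lc j (x, u)_{inl κ, inl l} · gaugeWt Lc y l u = 0` — every `j`, every coarse site `y`, every fine leg `(x, κ)`. -/
theorem tsum_E2_mul_gaugeWt_eq_zero (j : ℕ) (y : Site (d + 1)) (x : Site (d + 1)) (κ : Fin (d + 1)) :
    ∑' u, ∑ l, E2 d Lc j x u (Sum.inl κ) (Sum.inl l) * gaugeWt Lc y l u = 0 := by
  have hL : 1 ≤ Lc := Nat.one_le_iff_ne_zero.mpr (NeZero.ne Lc)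
  have h := tsum_E2_mul_grad_eq_zero (Lc := Lc) j κ x (φ := fun v : Site (d + 1) => if blk Lc v = y then (1 : ℝ) else 0)
    (finite_support_blockInd hL y)
  simpa only [gaugeWt_eq_grad] using h

/-- [folklore] The row form against the block pure gauge: `Σ'_x Σ_κ gaugeWt Lc y κ x · E2 d Lc j (x, u)_{inl κ, inl l} = 0`. -/
theorem tsum_gaugeWt_mul_E2_eq_zero (j : ℕ) (y : Site (d + 1)) (u : Site (d + 1)) (l : Fin (d + 1)) :
    ∑' x, ∑ κ, gaugeWt Lc y κ x * E2 d Lc j x u (Sum.inl κ) (Sum.inl l) = 0 := by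
  have hL : 1 ≤ Lc := Nat.one_le_iff_ne_zero.mpr (NeZero.ne Lc)
  have h := tsum_grad_mul_E2_eq_zero (Lc := Lc) j l u (φ := fun v : Site (d + 1) => if blk Lc v = y then (1 : ℝ) else 0)
    (finite_support_blockInd hL y)
  simpa only [gaugeWt_eq_grad] using h

/-- [folklore] **THE STEP CANDIDATE'S FIELD BLOCK KILLS THE BLOCK PURE GAUGE** (`j + 1`, any in-block root `ρ`):
`Σ'_u Σ_l bhKStepAt d ρ Lc (j+1) (x, u)_{inl κ, inl l} · gaugeWt Lc y l u = 0` (field block `= wVH • E2`, `bhKStepAt_succ_inl_inl`) — the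
`j ≥ 1` replacement for `curv_dz` in step (ii) of the (W-LH) derivation. -/
theorem tsum_bhKStepAt_succ_ff_mul_gaugeWt_eq_zero (ρ : Site (d + 1)) (j : ℕ) (y : Site (d + 1)) (x : Site (d + 1))
    (κ : Fin (d + 1)) :
    ∑' u, ∑ l, bhKStepAt d ρ Lc (j + 1) x u (Sum.inl κ) (Sum.inl l) * gaugeWt Lc y l u = 0 := by
  simp only [bhKStepAt_succ_inl_inl, mul_assoc, ← Finset.mul_sum]
  rw [tsum_mul_left, tsum_E2_mul_gaugeWt_eq_zero, mul_zero]

/-- [folklore] The same for any finitely supported potential (not only block indicators). -/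
theorem tsum_bhKStepAt_succ_ff_mul_grad_eq_zero (ρ : Site (d + 1)) (j : ℕ) (κ : Fin (d + 1)) (x : Site (d + 1))
    {φ : Site (d + 1) → ℝ} (hφ : (Function.support φ).Finite) :
    ∑' u, ∑ l, bhKStepAt d ρ Lc (j + 1) x u (Sum.inl κ) (Sum.inl l) * (φ (u + unitVec l) - φ u) = 0 := by
  simp only [bhKStepAt_succ_inl_inl, mul_assoc, ← Finset.mul_sum]
  rw [tsum_mul_left, tsum_E2_mul_grad_eq_zero (j + 1) κ x hφ, mul_zero]

end ValueHessian

end Summit.QuantumFields.BalabanUV.Beta.ValueHessianGauge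

end
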